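import Literature.IUT.LogThetaLattice.GlobalPacketsLGPProofs
import Mathlib.RingTheory.Idempotents
import Mathlib.Data.Fintype.Card
import Mathlib.Algebra.BigOperators.Pi
import HarnessLib

/-!
# [IUTchIII] Proposition 3.3 (i) «uniquely»: uniqueness of the decomposition of the global tensor packet into number fields

S. Mochizuki, *Inter-universal Teichmüller theory III*, kurims manuscript (May 2020), §3, Proposition 3.3
(i) "(Ring Structures)", p. 100 l. 5–13: "The field structure on the various `(†𝕄⊛_mod)_α`, for `α ∈ A`,
determine a ring structure on `(†𝕄⊛_mod)_A` with respect to which `(†𝕄⊛_mod)_A` decomposes, **uniquely**, as a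
direct sum of number fields." [claim: Mochizuki2012, status: disputed] (D-0012 claim key; the content proved
here is classical commutative algebra).

abc-iut cell, D-0068 sub-DAG `plan/L6/SUBDAG-IUTchIII-Prop-33i.md`, sub-node **IUTchIII:Prop3.3(i)/P33i-L04**
(`DecompositionUnique`), seat abc-iut-w5-d154. Companion of `GlobalPacketsLGP.lean` (abc-iut-L6-t4: the
packet `GlobalPacket F = ⊗_{α∈A} F α` and the EXISTENCE schemas `Prop33i_directSumOfNumberFields''`) and of
`GlobalPacketsLGPProofs.lean` (abc-iut-L6-t5: existence PROVED, `Prop33i_directSumOfNumberFields''_holds`;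
its header records the printed "uniquely" as not yet typed). PROOF-ONLY file (theorems, no `def`).

WHAT IS PROVED (all hypotheses in the declaration headers; classical source for the generic part:
M. F. Atiyah, I. G. Macdonald, *Introduction to Commutative Algebra* (1969), Ch. 1 Ex. 22 (ideals and primes of
a finite product of rings) and Thm. 8.7 (structure theorem for Artin rings — "uniquely (up to isomorphism) a
finite direct product of Artin local rings"; fields are the reduced Artin local rings)):
* `ringHom_pi_field_existsUnique_index`: a ring homomorphism from a FINITE product of fields `Π_i K_i` to a
  field sends exactly one of the standard idempotents `Pi.single i 1` to `1`;
* `ringHom_pi_field_apply_eq_apply_single`: it then factors through that coordinate;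
* `ringEquiv_pi_field_index_equiv`: a ring isomorphism `Π_{i∈ι} K_i ≃+* Π_{j∈κ} L_j` between finite
  products of fields is, up to a bijection `σ : ι ≃ κ`, a family of field isomorphisms `K_i ≃+* L_{σ i}`
  compatible with the projections;
* `ringEquiv_pi_field_unique`: hence two decompositions `R ≃+* Π_i K_i`, `R ≃+* Π_j L_j` of ONE commutative
  ring into finitely many fields have equivalent index sets and isomorphic, projection-compatible summands;
* `Prop33i_decomposition_unique`: the printed "uniquely" for the global tensor packet `GlobalPacket F`
  (uniqueness needs no number-field hypothesis; existence is `Prop33i_directSumOfNumberFields''_holds`).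

Nothing here bears on the disputed [IUTchIII] Cor. 3.12; typed ≠ endorsed; no side taken.
-/

namespace Literature.IUT.LogThetaLattice

open scoped BigOperators

universe u v

/-! ### Ring homomorphisms out of a finite product of fields -/

section PiField

variable {ι : Type*} {K : ι → Type*} [∀ i, Field (K i)] {E : Type*} [Field E]

/-- In a product of fields the standard idempotents `e_i = Pi.single i 1` are pairwise orthogonal (private
helper). [folklore] -/
private theorem pi_single_one_mul_single_one_of_ne [DecidableEq ι] {i i' : ι} (hne : i ≠ i') :
    (Pi.single i (1 : K i) : ∀ k, K k) * Pi.single i' 1 = 0 := by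
  ext k
  rcases eq_or_ne k i with rfl | hk
  · simp [Pi.single_eq_of_ne hne]
  · simp [Pi.single_eq_of_ne hk]

/-- A ring homomorphism from a finite product of fields `Π_i K_i` to a field `E` sends EXACTLY ONE standard
idempotent `Pi.single i 1` to `1` (the images are idempotents of a field, hence `0` or `1`; they are pairwise
orthogonal and sum to `1`) — the prime ideals of a finite product `Π_i A_i` are exactly the pull-backs of
primes of the factors along the projections. [cite: AtiyahMacdonald1969, Ch. 1 Ex. 22] -/
theorem ringHom_pi_field_existsUnique_index [Finite ι] [DecidableEq ι] (φ : (∀ i, K i) →+* E) :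
    ∃! i, φ (Pi.single i 1) = 1 := by
  cases nonempty_fintype ι
  have h01 : ∀ i, φ (Pi.single i (1 : K i)) = 0 ∨ φ (Pi.single i (1 : K i)) = 1 := fun i => by
    have hid : IsIdempotentElem (Pi.single i (1 : K i) : ∀ k, K k) := by
      rw [IsIdempotentElem, ← Pi.single_mul, mul_one]
    exact IsIdempotentElem.iff_eq_zero_or_one.mp (hid.map φ)
  have hsum : (∑ i, φ (Pi.single i (1 : K i))) = 1 := by
    rw [← map_sum]
    have h1 : (∑ i, Pi.single i ((1 : ∀ k, K k) i)) = (1 : ∀ k, K k) := Finset.univ_sum_single _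
    simp only [Pi.one_apply] at h1
    rw [h1, map_one]
  refine existsUnique_of_exists_of_unique ?_ ?_
  · by_contra h
    push Not at h
    have h0 : ∀ i, φ (Pi.single i (1 : K i)) = 0 := fun i => (h01 i).resolve_right (h i)
    rw [Finset.sum_eq_zero fun i _ => h0 i] at hsum
    exact zero_ne_one hsum
  · intro i i' hi hi'
    by_contra hne
    have := congrArg φ (pi_single_one_mul_single_one_of_ne (K := K) hne)
    rw [map_mul, hi, hi', map_zero, mul_one] at this
    exact one_ne_zero this

/-- A ring homomorphism from a finite product of fields factors through the coordinate `i` whose standard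
idempotent it sends to `1`: `φ x = φ (Pi.single i (x i))` (the kernel contains the ideal `(1 - e_i)`).
[cite: AtiyahMacdonald1969, Ch. 1 Ex. 22] -/
theorem ringHom_pi_field_apply_eq_apply_single [DecidableEq ι] (φ : (∀ i, K i) →+* E) {i : ι}
    (hi : φ (Pi.single i 1) = 1) (x : ∀ i, K i) : φ x = φ (Pi.single i (x i)) := by
  have hx : Pi.single i (x i) = x * Pi.single i 1 := by
    rw [← Pi.single_mul_right, mul_one]
  rw [hx, map_mul, hi, mul_one]

/-- If `φ` sends the standard idempotent of coordinate `i` to `1`, then every other standard idempotent goes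
to `0`, i.e. `φ (Pi.single i' a) = 0` for `i' ≠ i` (private helper). [folklore] -/
private theorem ringHom_pi_field_apply_single_of_ne [DecidableEq ι] (φ : (∀ i, K i) →+* E) {i i' : ι}
    (hi : φ (Pi.single i 1) = 1) (hne : i' ≠ i) (a : K i') : φ (Pi.single i' a) = 0 := by
  rw [ringHom_pi_field_apply_eq_apply_single φ hi (Pi.single i' a), Pi.single_eq_of_ne hne.symm,
    Pi.single_zero, map_zero]

end PiField

/-! ### Uniqueness of the decomposition of a ring as a finite product of fields -/

section Unique

variable {ι κ : Type*} {K : ι → Type*} {L : κ → Type*} [∀ i, Field (K i)] [∀ j, Field (L j)]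

/-- **Uniqueness of product-of-fields decompositions, isomorphism form.** A ring isomorphism
`h : Π_{i∈ι} K_i ≃+* Π_{j∈κ} L_j` between FINITE products of fields determines a bijection `σ : ι ≃ κ` and
field isomorphisms `g_i : K_i ≃+* L_{σ i}` with `g_i (x i) = (h x) (σ i)` for all `x` — i.e. `h` is a
"permutation of the factors followed by factorwise isomorphisms". Proof: for each `j` the composite
`Π_i K_i → Π_j L_j → L_j` kills all standard idempotents but one, `e_{τ j}`; `τ : κ → ι` is surjective (else
some `e_i ≠ 0` would map to `0`), and symmetrically for `h⁻¹`, so `τ` is a bijection of finite sets; the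
factorwise maps are ring homomorphisms between fields that are surjective via `h⁻¹`. This is the uniqueness
half of the structure theorem for Artin rings (fields being the Artin local rings with zero maximal ideal),
in projection-compatible form. [cite: AtiyahMacdonald1969, Thm 8.7 (uniqueness)] -/
theorem ringEquiv_pi_field_index_equiv [Finite ι] [Finite κ] (h : (∀ i, K i) ≃+* (∀ j, L j)) :
    ∃ σ : ι ≃ κ, ∀ i, ∃ g : K i ≃+* L (σ i), ∀ x : ∀ i, K i, g (x i) = h x (σ i) := by
  classical
  cases nonempty_fintype ι
  cases nonempty_fintype κ
  -- the composites with the projections, in both directions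
  let φ : ∀ j : κ, (∀ i, K i) →+* L j := fun j => (Pi.evalRingHom L j).comp h.toRingHom
  let ψ : ∀ i : ι, (∀ j, L j) →+* K i := fun i => (Pi.evalRingHom K i).comp h.symm.toRingHom
  have hφ : ∀ j x, φ j x = h x j := fun j x => rfl
  have hψ : ∀ i y, ψ i y = h.symm y i := fun i y => rfl
  -- the index maps
  choose τ hτ hτu using fun j => ringHom_pi_field_existsUnique_index (φ j)
  choose τ' hτ' hτ'u using fun i => ringHom_pi_field_existsUnique_index (ψ i)
  -- τ is surjective: if no `j` picks `i`, then `h (e_i) = 0`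
  have hτs : Function.Surjective τ := by
    intro i
    by_contra hno
    push Not at hno
    have hzero : h (Pi.single i (1 : K i)) = 0 := by
      funext j
      have := ringHom_pi_field_apply_single_of_ne (φ j) (hτ j) (hno j).symm (1 : K i)
      rw [hφ] at this
      rw [this, Pi.zero_apply]
    have : (Pi.single i (1 : K i) : ∀ k, K k) = 0 := by
      rw [← map_zero h] at hzero
      exact h.injective hzero
    have := congrFun this i
    rw [Pi.single_eq_same, Pi.zero_apply] at this
    exact one_ne_zero this
  have hτ's : Function.Surjective τ' := by
    intro j
    by_contra hno
    push Not at hno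
    have hzero : h.symm (Pi.single j (1 : L j)) = 0 := by
      funext i
      have := ringHom_pi_field_apply_single_of_ne (ψ i) (hτ' i) (hno i).symm (1 : L j)
      rw [hψ] at this
      rw [this, Pi.zero_apply]
    have : (Pi.single j (1 : L j) : ∀ k, L k) = 0 := by
      rw [← map_zero h.symm] at hzero
      exact h.symm.injective hzero
    have := congrFun this j
    rw [Pi.single_eq_same, Pi.zero_apply] at this
    exact one_ne_zero this
  -- hence τ is a bijection of finite sets
  have hcard : Fintype.card κ = Fintype.card ι :=
    le_antisymm (Fintype.card_le_of_surjective τ' hτ's) (Fintype.card_le_of_surjective τ hτs)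
  have hτb : Function.Bijective τ := (Fintype.bijective_iff_surjective_and_card τ).mpr ⟨hτs, hcard⟩
  let σ : ι ≃ κ := (Equiv.ofBijective τ hτb).symm
  have hστ : ∀ j, σ (τ j) = j := fun j => (Equiv.ofBijective τ hτb).symm_apply_apply j
  refine ⟨σ, fun i => ?_⟩
  obtain ⟨j, rfl⟩ := hτs i
  rw [hστ j]
  -- the factorwise ring homomorphism `K (τ j) → L j`, `a ↦ h (e_{τ j} · a) j`
  let f : K (τ j) →+* L j :=
    { toFun := fun a => h (Pi.single (τ j) a) j
      map_one' := hτ j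
      map_mul' := fun a b => by
        simp only [Pi.single_mul, map_mul, Pi.mul_apply]
      map_zero' := by simp only [Pi.single_zero, map_zero, Pi.zero_apply]
      map_add' := fun a b => by
        simp only [Pi.single_add, map_add, Pi.add_apply] }
  have hf : ∀ a, f a = h (Pi.single (τ j) a) j := fun a => rfl
  have hfact : ∀ x : ∀ i, K i, f (x (τ j)) = h x j := fun x => by
    rw [hf, ← hφ, ← hφ, ← ringHom_pi_field_apply_eq_apply_single (φ j) (hτ j) x]
  have hbij : Function.Bijective f := by
    refine ⟨f.injective, fun y => ?_⟩
    refine ⟨h.symm (Pi.single j y) (τ j), ?_⟩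
    rw [hfact, RingEquiv.apply_symm_apply, Pi.single_eq_same]
  exact ⟨RingEquiv.ofBijective f hbij, fun x => by rw [RingEquiv.ofBijective_apply, hfact]⟩

/-- **Uniqueness of product-of-fields decompositions.** Two decompositions `e : R ≃+* Π_{i∈ι} K_i` and
`f : R ≃+* Π_{j∈κ} L_j` of one commutative ring `R` as FINITE products of fields differ by a bijection of the
index sets and projection-compatible field isomorphisms of the summands: `g_i (e r i) = f r (σ i)`.
(Equivalently: the summands are the residue fields of `R` at its finitely many maximal ideals — the
uniqueness statement of the structure theorem for Artin rings in the reduced case.)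
[cite: AtiyahMacdonald1969, Thm 8.7 (uniqueness)] -/
theorem ringEquiv_pi_field_unique {R : Type*} [CommRing R] [Finite ι] [Finite κ]
    (e : R ≃+* ∀ i, K i) (f : R ≃+* ∀ j, L j) :
    ∃ σ : ι ≃ κ, ∀ i, ∃ g : K i ≃+* L (σ i), ∀ r : R, g (e r i) = f r (σ i) := by
  obtain ⟨σ, hσ⟩ := ringEquiv_pi_field_index_equiv (e.symm.trans f)
  refine ⟨σ, fun i => ?_⟩
  obtain ⟨g, hg⟩ := hσ i
  exact ⟨g, fun r => by simpa using hg (e r)⟩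

/-- In particular the NUMBER of summands is well defined. [cite: AtiyahMacdonald1969, Thm 8.7 (uniqueness)] -/
theorem ringEquiv_pi_field_card_eq {R : Type*} [CommRing R] [Finite ι] [Finite κ]
    (e : R ≃+* ∀ i, K i) (f : R ≃+* ∀ j, L j) : Nat.card ι = Nat.card κ := by
  obtain ⟨σ, -⟩ := ringEquiv_pi_field_unique e f
  exact Nat.card_congr σ

end Unique

/-! ### [IUTchIII] Proposition 3.3 (i): the printed «uniquely» for the global tensor packet -/

section Prop33i

/-- **IUTchIII:Prop3.3(i)/P33i-L04** ([IUTchIII] Proposition 3.3 (i), kurims p. 100 l. 13, «decomposes,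
uniquely, as a direct sum of number fields»): any two decompositions of the global tensor packet
`(†𝕄⊛_mod)_A = GlobalPacket F = ⊗_{α∈A} F α` as finite products of fields
`e : GlobalPacket F ≃+* Π_{i∈ι} K_i`, `f : GlobalPacket F ≃+* Π_{j∈κ} L_j` are related by a bijection
`σ : ι ≃ κ` of the index sets and field isomorphisms `K_i ≃+* L_{σ i}` compatible with the two projections.
Uniqueness needs NO hypothesis on the factors `F α` (it holds for every commutative ring); EXISTENCE for
number fields `F α` and finite `A` is `Prop33i_directSumOfNumberFields''_holds` (abc-iut-L6-t5), so together
they type the whole first sentence of (i). [claim: Mochizuki2012, status: disputed] -/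
theorem Prop33i_decomposition_unique {A : Type v} (F : A → Type u) [∀ α, Field (F α)]
    [∀ α, Algebra ℚ (F α)] {ι κ : Type*} [Finite ι] [Finite κ] {K : ι → Type*} {L : κ → Type*}
    [∀ i, Field (K i)] [∀ j, Field (L j)]
    (e : GlobalPacket F ≃+* ∀ i, K i) (f : GlobalPacket F ≃+* ∀ j, L j) :
    ∃ σ : ι ≃ κ, ∀ i, ∃ g : K i ≃+* L (σ i), ∀ x : GlobalPacket F, g (e x i) = f x (σ i) :=
  ringEquiv_pi_field_unique e f

/-- **IUTchIII:Prop3.3(i)**, first sentence, EXISTENCE ∧ UNIQUENESS packaged (kurims p. 100 l. 5–13): for a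
finite family of number fields `F α` the global tensor packet decomposes as a finite product of number
fields (`Literature.IUT.LogThetaLattice.Prop33i_directSumOfNumberFields''`, PROVED by abc-iut-L6-t5), and any
two such decompositions have the same number of summands. [claim: Mochizuki2012, status: disputed] -/
theorem Prop33i_directSumOfNumberFields''_holds_and_card_unique {A : Type v} [Fintype A] [DecidableEq A]
    (F : A → Type u) [∀ α, Field (F α)] [∀ α, NumberField (F α)] [∀ α, Algebra ℚ (F α)] :
    Literature.IUT.LogThetaLattice.Prop33i_directSumOfNumberFields'' F ∧
      ∀ {ι κ : Type (max u v)} [Finite ι] [Finite κ] {K : ι → Type (max u v)} {L : κ → Type (max u v)}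
        [∀ i, Field (K i)] [∀ j, Field (L j)],
        Nonempty (GlobalPacket F ≃+* ∀ i, K i) → Nonempty (GlobalPacket F ≃+* ∀ j, L j) →
          Nat.card ι = Nat.card κ :=
  ⟨Prop33i_directSumOfNumberFields''_holds F,
    fun ⟨e⟩ ⟨f⟩ => ringEquiv_pi_field_card_eq e f⟩

end Prop33i

end Literature.IUT.LogThetaLattice
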